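import Literature.MathematicalPhysics.QuantumFieldTheory.Balaban1983to89.B9CoReadingCoordsTranspose
import Literature.MathematicalPhysics.QuantumFieldTheory.Balaban1983to89.B9CoReadingCoordsH
import Literature.MathematicalPhysics.QuantumFieldTheory.Balaban1983to89.B9Thm311AdjointPairs
import Literature.MathematicalPhysics.QuantumFieldTheory.Balaban1983to89.B9Thm311ProjectionR

/-!
# `Balaban1983to89.Node00.OpsYSectDCoords` — THE SECT.-D IDENTITY LAYER OF THE KNIT AT def-Y's LETTERS, IN COORDINATES: the pinned models of the
# eleven free `Ops` fields (`S0 ∕ Tpi ∕ T2 ∕ Q ∕ Qstar ∕ C ∕ C1 ∕ Dv ∕ Dvstar ∕ R`; `G0` is n06-d's `GcoK` of `G_A`) with the scalings forced by `GcoK ∕ HcoK`,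
# and TEN of the thirteen fields of `B9Thm312Whole.Identities` proved at them (`invG0′ ∕ invG ∕ invG1 ∕ eq126 ∕ eq129 ∕ eq153 ∕ c1_inv ∕ adjQ ∕ adjDv ∕ symmR`);
# the bookkeeping that carries them: the two-carrier transpose dictionary, the `coordOpK ∕ coordOpKH` functor calculus, `0 < cR39 (trBasis N)`.
# NOT HERE (located gap O5, `IDENTITIES-AT-LETTERS.md` §4): `h124Q ∕ h124R ∕ hR` — (3.115)∕(3.124) fail for the typed reading of `Q(U)` at curved `U`.

T. Bałaban, *Propagators for lattice gauge theories in a background field*, Commun. Math. Phys. **99** (1985) 389–434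
[`Balaban1985BackgroundPropagators`, "B9"].  statement-level skeleton of published theorems with citation tags; proofs where landed; nothing here is a
claim about the Yang–Mills mass gap.

CONSUMERS.  dag-n06-l's schema split `B9Thm312WholeIdentitiesSplit.IdentitiesDef` (the ten fields below, bus WORD-O5 2026-08-27) and dag-n06-d's N06-at-record
editions (`Summits/…/BalabanUVNodesN06AtOpsYNuOfRecordV6E*.lean`), which pin the `Ops` fields `G ∕ G1 ∕ GG ∕ D ∕ Dstar ∕ Hm ∕ H1m` to `GcoK ∕ DcoK ∕ DscoK ∕ HcoK`
and may now pin `S0 ∕ Tpi ∕ T2 ∕ Q ∕ Qstar ∕ C ∕ C1 ∕ Dv ∕ Dvstar ∕ R` to §5 and discharge `IdentitiesDef` field by field with §6–§7.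
* §1 the `coordOpK ∕ coordOpKH` functor calculus: `repr_assembleK`, ★ `coordOpK_id` (unit), `coordOpK_add ∕ _sub ∕ _smul ∕ _const_mul ∕ _const_one`,
  `coordOpKH_eq_coordOpK`, ★ `coordOpKH_comp_coordOpK`, ★ `coordOpKH_comp_coordOpKH`, `coordOpKH_sub ∕ _smul`;
* §2 the TWO-CARRIER transpose dictionary: ★ `isTransposePair_coordOpKH_of_adjoint`, ★★ `isTransposePair_coordOpKH_of_isAdjTr` (`IsAdjTr 1 1 (T ν) (T′ ν)` ⇒
  transpose models over a trace-orthonormal basis), `isTransposePair_coordOpKH_trBasis` (+ private plumbing `isTransposePair_smul_smul ∕ _iff_dotProduct`);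
* §3 `cR39_trBasis_pos`; §4 the dictionary inhabited at def-Y's `Q ∕ Q*` and `D_U ∕ D*_U` (`isTransposePair_QY_QsY_coords`, `isTransposePair_gradY_divY_coords`);
* §4b helpers; §5 the pinned models `S0coK TpicoK T2coK QcoKH QscoKH CcoK C1coK DvcoKH DvscoKH RcoK`;
* §6 ★★ `GcoK_GAY_mul_S0coK` (invG0′), `S0coK_sub_TpicoK_mul_GcoK_GDY` (invG), `S0coK_sub_mul_GcoK_G1Y` (invG1), `HcoK_HDY_eq` (eq126), `HcoK_H1Y_eq` (eq129),
  `QcoKH_G1_Qs_C1_eq_id` (c1_inv), ★★ `GcoK_GGY_eq_frakPstar` (eq153); §7 ★★ `isTransposePair_QcoKH_QscoKH` (adjQ), `isTransposePair_DvcoKH_DvscoKH` (adjDv),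
  `isTransposePair_RcoK` (symmR).
HONEST SCOPE.  Finite-dimensional linear algebra over def-Y's letters; the identities are def-Y's Sect.-D algebra (`OpsYSectDE` §3) transported through n06-d's
coordinate model, each under its displayed `IsUnit` ∕ `G`-valued-configuration hypothesis; nothing of [B9]'s estimates asserted; `h124Q ∕ h124R ∕ hR` NOT
claimed (O5).  Count-neutral; N06 NOT discharged; one finite lattice programme at fixed ε; nothing continuum ∕ ℝ⁴ ∕ OS ∕ mass gap ∕ Clay.  Cell `pub-ymgap`
(D-0062), node N06 [B9] at NODE 00's instance, seat `pub-ymgap-node00-def-Y` (g10), 2026-08-27.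
-/

noncomputable section

namespace Literature.MathematicalPhysics.QuantumFieldTheory.Balaban1983to89.Node00.OpsYSectDCoords

open B9Thm37Glue (IsTransposePair)
open B9CoReadingCoords (assembleK coordOpK coordOpK_apply assembleK_coordOpK)
open B9CoReadingCoordsH (coordOpKH coordOpKH_apply assembleK_coordOpKH)
open B9CoReadingCoordsTranspose (assembleK_pairing trReForm trReForm_apply trReForm_symm sum_trReForm_eq_trIP TrIdx trBasis trBasis_repr_eq_trace)
open B9Thm311ReadingCoords (trIP IsAdjTr)
open B9Thm39ReadingCoords (cR39 coordBound39 basisBound39)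
open scoped Matrix
open scoped Matrix.Norms.L2Operator

variable {𝔸 : Type} [NormedRing 𝔸] [NormedAlgebra ℂ 𝔸]
variable {κ : Type} [Fintype κ]
variable {S S' S'' D : Type}

/-! ## §1 The `coordOpK ∕ coordOpKH` functor calculus (unit, linearity in the family, mixed composites) -/

section Functor

variable (b : Module.Basis κ ℝ 𝔸)

/-- the coordinates of a re-assembled slice are the coordinates one started from. [cite: Balaban1985BackgroundPropagators, (3.42) p.397, dictionary] -/
theorem repr_assembleK (f : S × D × κ × κ → ℝ) (x : S) (ν : D) (c c' : κ) : b.repr (assembleK b ν c' f x) c = f (x, ν, c, c') := by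
  have h : assembleK b ν c' f x = b.equivFun.symm (fun a => f (x, ν, a, c')) := by
    rw [Module.Basis.equivFun_symm_apply]; rfl
  rw [h, ← Module.Basis.equivFun_apply, LinearEquiv.apply_symm_apply]

/-- ★ UNIT: the coordinate model of the identity family is the identity. [cite: Balaban1985BackgroundPropagators, (3.42) p.397, dictionary] -/
theorem coordOpK_id : coordOpK b (fun _ : D => (LinearMap.id : (S → 𝔸) →ₗ[ℝ] (S → 𝔸))) = LinearMap.id := by
  apply LinearMap.ext; intro f; funext p
  rw [coordOpK_apply, LinearMap.id_apply, LinearMap.id_apply, repr_assembleK]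

/-- additivity in the family. [cite: Balaban1985BackgroundPropagators, (3.42) p.397, dictionary] -/
theorem coordOpK_add (T T' : D → (S → 𝔸) →ₗ[ℝ] (S → 𝔸)) : coordOpK b (fun ν => T ν + T' ν) = coordOpK b T + coordOpK b T' := by
  apply LinearMap.ext; intro f; funext p
  simp only [coordOpK_apply, LinearMap.add_apply, Pi.add_apply, map_add, Finsupp.coe_add]

/-- subtraction in the family. [cite: Balaban1985BackgroundPropagators, (3.42) p.397, dictionary] -/
theorem coordOpK_sub (T T' : D → (S → 𝔸) →ₗ[ℝ] (S → 𝔸)) : coordOpK b (fun ν => T ν - T' ν) = coordOpK b T - coordOpK b T' := by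
  apply LinearMap.ext; intro f; funext p
  simp only [coordOpK_apply, LinearMap.sub_apply, Pi.sub_apply, map_sub, Finsupp.coe_sub]

/-- homogeneity in the family. [cite: Balaban1985BackgroundPropagators, (3.42) p.397, dictionary] -/
theorem coordOpK_smul (r : ℝ) (T : D → (S → 𝔸) →ₗ[ℝ] (S → 𝔸)) : coordOpK b (fun ν => r • T ν) = r • coordOpK b T := by
  apply LinearMap.ext; intro f; funext p
  simp only [coordOpK_apply, LinearMap.smul_apply, Pi.smul_apply, map_smul, Finsupp.coe_smul, smul_eq_mul]

/-- the constant family of a product is the composite of the constant families. [cite: Balaban1985BackgroundPropagators, (3.42) p.397, dictionary] -/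
theorem coordOpK_const_mul (A B : Module.End ℝ (S → 𝔸)) : coordOpK b (fun _ : D => A * B) = coordOpK b (fun _ : D => A) * coordOpK b (fun _ : D => B) := by
  simp only [Module.End.mul_eq_comp]
  rw [B9CoReadingCoords.coordOpK_comp]

/-- the constant family of `1` is `1`. [cite: Balaban1985BackgroundPropagators, (3.42) p.397, dictionary] -/
theorem coordOpK_const_one : coordOpK b (fun _ : D => (1 : Module.End ℝ (S → 𝔸))) = 1 := coordOpK_id b

/-- on equal carriers the mixed model IS the plain model. [cite: Balaban1985BackgroundPropagators, (3.126) p.420, dictionary] -/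
theorem coordOpKH_eq_coordOpK (T : D → (S → 𝔸) →ₗ[ℝ] (S → 𝔸)) : coordOpKH b T = coordOpK b T := rfl

/-- ★ FUNCTORIALITY (mixed ∘ plain). [cite: Balaban1985BackgroundPropagators, (3.126) p.420 («GQ*C»), dictionary] -/
theorem coordOpKH_comp_coordOpK (T : D → (S' → 𝔸) →ₗ[ℝ] (S → 𝔸)) (T' : D → (S' → 𝔸) →ₗ[ℝ] (S' → 𝔸)) :
    coordOpKH b T ∘ₗ coordOpK b T' = coordOpKH b (fun ν => T ν ∘ₗ T' ν) := by
  apply LinearMap.ext; intro f; funext p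
  simp only [LinearMap.comp_apply, coordOpKH_apply, assembleK_coordOpK]

/-- ★ FUNCTORIALITY (mixed ∘ mixed). [cite: Balaban1985BackgroundPropagators, (3.127) p.420 («QG₁Q*C₁ = I»), dictionary] -/
theorem coordOpKH_comp_coordOpKH (T : D → (S' → 𝔸) →ₗ[ℝ] (S → 𝔸)) (T' : D → (S'' → 𝔸) →ₗ[ℝ] (S' → 𝔸)) :
    coordOpKH b T ∘ₗ coordOpKH b T' = coordOpKH b (fun ν => T ν ∘ₗ T' ν) := by
  apply LinearMap.ext; intro f; funext p
  simp only [LinearMap.comp_apply, coordOpKH_apply, assembleK_coordOpKH]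

/-- additivity in the family (mixed). [cite: Balaban1985BackgroundPropagators, (3.126) p.420, dictionary] -/
theorem coordOpKH_sub (T T' : D → (S' → 𝔸) →ₗ[ℝ] (S → 𝔸)) : coordOpKH b (fun ν => T ν - T' ν) = coordOpKH b T - coordOpKH b T' := by
  apply LinearMap.ext; intro f; funext p
  simp only [coordOpKH_apply, LinearMap.sub_apply, Pi.sub_apply, map_sub, Finsupp.coe_sub]

/-- homogeneity in the family (mixed). [cite: Balaban1985BackgroundPropagators, (3.126) p.420, dictionary] -/
theorem coordOpKH_smul (r : ℝ) (T : D → (S' → 𝔸) →ₗ[ℝ] (S → 𝔸)) : coordOpKH b (fun ν => r • T ν) = r • coordOpKH b T := by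
  apply LinearMap.ext; intro f; funext p
  simp only [coordOpKH_apply, LinearMap.smul_apply, Pi.smul_apply, map_smul, Finsupp.coe_smul, smul_eq_mul]

end Functor

/-! ## §2 The two-carrier transpose dictionary: adjoint letter families `T ν : (S′ → 𝔸) → (S → 𝔸)`, `T′ ν : (S → 𝔸) → (S′ → 𝔸)` have transpose models -/

section Transpose

variable [Fintype S] [Fintype S'] [Fintype D]

/-- ★ **ADJOINT LETTER FAMILIES BETWEEN TWO CARRIERS HAVE TRANSPOSE COORDINATE MODELS** (the two-carrier twin of n06-d's
`isTransposePair_coordOpK_of_adjoint`; no symmetry of `β` needed in this form): for a real pairing `β` with `b` orthonormal and `Σ_x β(Ψ x)(T Φ x) = Σ_{x′} β(Φ x′)(T′ Ψ x′)`,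
`IsTransposePair (coordOpKH b T) (coordOpKH b T′)`. [cite: Balaban1985BackgroundPropagators, p.393 (Q′* the adjoint of Q′), (3.13) p.393; Balaban1984PropagatorsII, (2.51) p.232] -/
theorem isTransposePair_coordOpKH_of_adjoint (b : Module.Basis κ ℝ 𝔸) (β : 𝔸 →ₗ[ℝ] 𝔸 →ₗ[ℝ] ℝ)
    (hb : ∀ (v : 𝔸) (c : κ), b.repr v c = β (b c) v) (T : D → (S' → 𝔸) →ₗ[ℝ] (S → 𝔸)) (T' : D → (S → 𝔸) →ₗ[ℝ] (S' → 𝔸))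
    (hT : ∀ (ν : D) (Φ : S' → 𝔸) (Ψ : S → 𝔸), ∑ x, β (Ψ x) (T ν Φ x) = ∑ x', β (Φ x') (T' ν Ψ x')) :
    IsTransposePair (coordOpKH b T) (coordOpKH b T') := by
  intro u v
  have hL : ∑ p : S × D × κ × κ, coordOpKH b T u p * v p = ∑ ν : D, ∑ c' : κ, ∑ x : S, β (assembleK b ν c' v x) (T ν (assembleK b ν c' u) x) := by
    simp only [coordOpKH_apply, hb]
    rw [Fintype.sum_prod_type]
    simp only [Fintype.sum_prod_type (f := fun q : D × κ × κ => _)]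
    rw [Finset.sum_comm]
    refine Finset.sum_congr rfl fun ν _ => ?_
    rw [Finset.sum_comm]
    simp only [Fintype.sum_prod_type (f := fun q : κ × κ => _)]
    rw [Finset.sum_comm]
    refine Finset.sum_congr rfl fun c' _ => ?_
    rw [Finset.sum_comm]
    refine Finset.sum_congr rfl fun x _ => ?_
    rw [← assembleK_pairing b β v x ν c']
    refine Finset.sum_congr rfl fun c _ => ?_
    ring
  have hR : ∑ p : S' × D × κ × κ, u p * coordOpKH b T' v p = ∑ ν : D, ∑ c' : κ, ∑ x : S', β (assembleK b ν c' u x) (T' ν (assembleK b ν c' v) x) := by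
    simp only [coordOpKH_apply, hb]
    rw [Fintype.sum_prod_type]
    simp only [Fintype.sum_prod_type (f := fun q : D × κ × κ => _)]
    rw [Finset.sum_comm]
    refine Finset.sum_congr rfl fun ν _ => ?_
    rw [Finset.sum_comm]
    simp only [Fintype.sum_prod_type (f := fun q : κ × κ => _)]
    rw [Finset.sum_comm]
    refine Finset.sum_congr rfl fun c' _ => ?_
    rw [Finset.sum_comm]
    refine Finset.sum_congr rfl fun x _ => ?_
    rw [← assembleK_pairing b β u x ν c']
  rw [hL, hR]
  exact Finset.sum_congr rfl fun ν _ => Finset.sum_congr rfl fun c' _ => hT ν _ _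

variable {N : ℕ}

/-- ★★ **`IsAdjTr 1 1 (T ν) (T′ ν)` ⇒ `IsTransposePair (coordOpKH b T·) (coordOpKH b T′·)`** over a trace-orthonormal real basis of `M_N(ℂ)` — the knit's
`adjQ ∕ adjDv` shape from n06-j's adjoint pairs. [cite: Balaban1985BackgroundPropagators, (3.13) p.393 (Q* the adjoint of Q), (3.8) p.392 (∇* of ∇)] -/
theorem isTransposePair_coordOpKH_of_isAdjTr (b : Module.Basis κ ℝ (Matrix (Fin N) (Fin N) ℂ))
    (hb : ∀ (v : Matrix (Fin N) (Fin N) ℂ) (c : κ), b.repr v c = (Matrix.trace ((b c)ᴴ * v)).re)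
    (T : D → (S' → Matrix (Fin N) (Fin N) ℂ) →ₗ[ℂ] (S → Matrix (Fin N) (Fin N) ℂ)) (T' : D → (S → Matrix (Fin N) (Fin N) ℂ) →ₗ[ℂ] (S' → Matrix (Fin N) (Fin N) ℂ))
    (hT : ∀ ν, IsAdjTr (fun _ => (1 : ℝ)) (fun _ => (1 : ℝ)) (T ν) (T' ν)) :
    IsTransposePair (coordOpKH (𝔸 := Matrix (Fin N) (Fin N) ℂ) b (fun ν => (T ν).restrictScalars ℝ))
      (coordOpKH (𝔸 := Matrix (Fin N) (Fin N) ℂ) b (fun ν => (T' ν).restrictScalars ℝ)) := by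
  refine isTransposePair_coordOpKH_of_adjoint b trReForm (fun v c => by rw [hb, trReForm_apply]) _ _ fun ν Φ Ψ => ?_
  simp only [LinearMap.coe_restrictScalars]
  rw [sum_trReForm_eq_trIP, sum_trReForm_eq_trIP]
  have h1 : trIP (fun _ => (1 : ℝ)) Ψ (T ν Φ) = trIP (fun _ => (1 : ℝ)) (T ν Φ) Ψ := by
    rw [← sum_trReForm_eq_trIP, ← sum_trReForm_eq_trIP]; exact Finset.sum_congr rfl fun x _ => trReForm_symm _ _
  rw [h1]
  exact hT ν Φ Ψ

/-- the same over `trBasis N`: NO basis hypothesis. [cite: Balaban1985BackgroundPropagators, (3.13) p.393, p.393 (scalar products)] -/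
theorem isTransposePair_coordOpKH_trBasis
    (T : D → (S' → Matrix (Fin N) (Fin N) ℂ) →ₗ[ℂ] (S → Matrix (Fin N) (Fin N) ℂ)) (T' : D → (S → Matrix (Fin N) (Fin N) ℂ) →ₗ[ℂ] (S' → Matrix (Fin N) (Fin N) ℂ))
    (hT : ∀ ν, IsAdjTr (fun _ => (1 : ℝ)) (fun _ => (1 : ℝ)) (T ν) (T' ν)) :
    IsTransposePair (coordOpKH (𝔸 := Matrix (Fin N) (Fin N) ℂ) (trBasis N) (fun ν => (T ν).restrictScalars ℝ))
      (coordOpKH (𝔸 := Matrix (Fin N) (Fin N) ℂ) (trBasis N) (fun ν => (T' ν).restrictScalars ℝ)) :=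
  isTransposePair_coordOpKH_of_isAdjTr (trBasis N) (trBasis_repr_eq_trace N) T T' hT

/-- a transpose pair scaled on both sides by the same real is a transpose pair. [folklore] -/
private theorem isTransposePair_smul_smul {X Y : Type} [Fintype X] [Fintype Y] {A : (X → ℝ) →ₗ[ℝ] (Y → ℝ)} {B : (Y → ℝ) →ₗ[ℝ] (X → ℝ)}
    (h : IsTransposePair A B) (r : ℝ) : IsTransposePair (r • A) (r • B) := by
  intro u v
  simp only [LinearMap.smul_apply, Pi.smul_apply, smul_eq_mul]
  calc ∑ y, r * A u y * v y = r * ∑ y, A u y * v y := by rw [Finset.mul_sum]; exact Finset.sum_congr rfl fun y _ => by ring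
    _ = r * ∑ x, u x * B v x := by rw [h u v]
    _ = ∑ x, u x * (r * B v x) := by rw [Finset.mul_sum]; exact Finset.sum_congr rfl fun x _ => by ring

/-- `IsTransposePair A B` IS the knit's `∀ f b, A f ⬝ᵥ b = f ⬝ᵥ B b`. [folklore] -/
private theorem isTransposePair_iff_dotProduct {X Y : Type} [Fintype X] [Fintype Y] (A : (X → ℝ) →ₗ[ℝ] (Y → ℝ)) (B : (Y → ℝ) →ₗ[ℝ] (X → ℝ)) :
    IsTransposePair A B ↔ ∀ (f : X → ℝ) (g : Y → ℝ), A f ⬝ᵥ g = f ⬝ᵥ B g := Iff.rfl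

end Transpose

/-! ## §3 The reading constant of the trace basis is positive -/

section Constant

variable {N : ℕ}

/-- `0 < cR39 (trBasis N)` for `N ≥ 1` (a basis vector is non-zero, the coordinate map is non-zero, `|TrIdx N| = 2N² > 0`).
[cite: Balaban1985BackgroundPropagators, (3.48) p.398, bookkeeping] -/
theorem cR39_trBasis_pos (hN : 0 < N) : 0 < cR39 (trBasis N) := by
  have c₀ : TrIdx N := (⟨0, hN⟩, ⟨0, hN⟩, 0)
  have hb0 : trBasis N c₀ ≠ 0 := (trBasis N).ne_zero c₀
  unfold cR39
  refine mul_pos (mul_pos ?_ ?_) ?_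
  · -- the coordinate map is a non-zero continuous linear map
    unfold coordBound39
    refine norm_pos_iff.mpr fun h => ?_
    have h1 : (LinearMap.toContinuousLinearMap (trBasis N).equivFun.toLinearMap) (trBasis N c₀) c₀ = 0 := by rw [h]; rfl
    simp at h1
  · unfold basisBound39
    exact lt_of_lt_of_le (norm_pos_iff.mpr hb0) (Finset.single_le_sum (f := fun c => ‖trBasis N c‖) (fun _ _ => norm_nonneg _) (Finset.mem_univ c₀))
  · have : 0 < Fintype.card (TrIdx N) := Fintype.card_pos_iff.mpr ⟨c₀⟩
    exact_mod_cast this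

end Constant

/-! ## §4 INHABITED at def-Y's letters: `Q(U) ∕ Q*(U)` and `D_U ∕ D*_U` read in coordinates are transpose pairs (the knit's `adjQ ∕ adjDv`) -/

section AtLetters

open B6KLevelCensusIndexV1 (KIdx)

variable {N : ℕ} {d ℓ : ℕ} {hd : 1 ≤ d + 1} {hL : Odd (ℓ + 1) ∧ 1 < ℓ + 1} {b₀ b₁ : ℝ} (i : KIdx d ℓ hd hL b₀ b₁)
  (B : B9.Backgrounds) (cfg : B.Cfg → CfgY (Matrix (Fin N) (Fin N) ℂ) i) (U₁ : B.Cfg)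

/-- ★★ the knit's `adjQ` at the letters: for a `G`-valued configuration, `G ≤ U(N)`, the coordinate models of `Q(U)` and `Q*(U)` (any common real scaling)
are a transpose pair. [cite: Balaban1985BackgroundPropagators, (3.13) p.393 (Q* the adjoint of Q), (3.35) p.396] -/
theorem isTransposePair_QY_QsY_coords {G : Subgroup (Matrix (Fin N) (Fin N) ℂ)ˣ} (hG : G ≤ B7Prop2Explicit.unitaryUnits (Matrix (Fin N) (Fin N) ℂ))
    (hU : ∀ μ x, cfg U₁ μ x ∈ G) (r : ℝ) :
    IsTransposePair (r • coordOpKH (𝔸 := Matrix (Fin N) (Fin N) ℂ) (trBasis N) (fun _ : Fin (d + 1) => (QY i (parBY i) (cfg U₁)).restrictScalars ℝ))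
      (r • coordOpKH (𝔸 := Matrix (Fin N) (Fin N) ℂ) (trBasis N) (fun _ : Fin (d + 1) => (QsY i (parBY i) (cfg U₁)).restrictScalars ℝ)) :=
  isTransposePair_smul_smul (isTransposePair_coordOpKH_trBasis _ _ fun _ => B9Thm311AdjointPairs.isAdjTr_QY_QsY_parBY i hG (cfg U₁) hU) r

/-- ★★ the knit's `adjDv` at the letters: at a unitary-valued configuration the coordinate models of `D_U` (sites → bonds) and `D*_U` are a transpose pair.
[cite: Balaban1985BackgroundPropagators, (3.8) p.392 (∇* the adjoint of ∇), (3.124) p.420] -/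
theorem isTransposePair_gradY_divY_coords
    (hU : ∀ μ x, ((cfg U₁ μ x : (Matrix (Fin N) (Fin N) ℂ)ˣ) : Matrix (Fin N) (Fin N) ℂ) ∈ unitary (Matrix (Fin N) (Fin N) ℂ)) :
    IsTransposePair (coordOpKH (𝔸 := Matrix (Fin N) (Fin N) ℂ) (trBasis N) (fun _ : Fin (d + 1) => (gradY i (cfg U₁)).restrictScalars ℝ))
      (coordOpKH (𝔸 := Matrix (Fin N) (Fin N) ℂ) (trBasis N) (fun _ : Fin (d + 1) => (divY i (cfg U₁)).restrictScalars ℝ)) :=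
  isTransposePair_coordOpKH_trBasis _ _ fun _ => B9Thm311AdjointPairs.isAdjTr_gradY_divY i (cfg U₁) hU

end AtLetters


/-! ## §4b Helpers: scalars through composites, `restrictScalars` through the ring operations, constant-family functor calculus -/

section Helpers

variable (b : Module.Basis κ ℝ 𝔸)

/-- scalars of a composite of scaled maps. [folklore] -/
private theorem smul_comp_smul {X₁ X₂ X₃ : Type} (r s : ℝ) (A : (X₂ → ℝ) →ₗ[ℝ] (X₃ → ℝ)) (C : (X₁ → ℝ) →ₗ[ℝ] (X₂ → ℝ)) :
    (r • A) ∘ₗ (s • C) = (r * s) • (A ∘ₗ C) := by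
  rw [LinearMap.smul_comp, LinearMap.comp_smul, smul_smul]

/-- `restrictScalars` of a product (definitional). [folklore] -/
private theorem restrictScalars_mul' {T : Type} (f g : Module.End ℂ (T → 𝔸)) : (f * g).restrictScalars ℝ = f.restrictScalars ℝ * g.restrictScalars ℝ := rfl

/-- `restrictScalars` of `1` is `1` (definitional). [folklore] -/
private theorem restrictScalars_one' {T : Type} : (1 : Module.End ℂ (T → 𝔸)).restrictScalars ℝ = 1 := rfl

/-- `restrictScalars` of a difference (definitional). [folklore] -/
private theorem restrictScalars_sub' {T T' : Type} (f g : (T → 𝔸) →ₗ[ℂ] (T' → 𝔸)) : (f - g).restrictScalars ℝ = f.restrictScalars ℝ - g.restrictScalars ℝ := rfl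

/-- `restrictScalars` of a sum (definitional). [folklore] -/
private theorem restrictScalars_add' {T T' : Type} (f g : (T → 𝔸) →ₗ[ℂ] (T' → 𝔸)) : (f + g).restrictScalars ℝ = f.restrictScalars ℝ + g.restrictScalars ℝ := rfl

/-- constant families: difference. [cite: Balaban1985BackgroundPropagators, (3.42) p.397, dictionary] -/
theorem coordOpK_const_sub {T D' : Type} (A C : Module.End ℝ (T → 𝔸)) :
    coordOpK b (fun _ : D' => A - C) = coordOpK b (fun _ : D' => A) - coordOpK b (fun _ : D' => C) := coordOpK_sub b _ _

/-- constant families: sum. [cite: Balaban1985BackgroundPropagators, (3.42) p.397, dictionary] -/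
theorem coordOpK_const_add {T D' : Type} (A C : Module.End ℝ (T → 𝔸)) :
    coordOpK b (fun _ : D' => A + C) = coordOpK b (fun _ : D' => A) + coordOpK b (fun _ : D' => C) := coordOpK_add b _ _

/-- constant families: composite. [cite: Balaban1985BackgroundPropagators, (3.42) p.397, dictionary] -/
theorem coordOpK_const_comp {T D' : Type} (A C : Module.End ℝ (T → 𝔸)) :
    coordOpK b (fun _ : D' => A ∘ₗ C) = coordOpK b (fun _ : D' => A) ∘ₗ coordOpK b (fun _ : D' => C) := (B9CoReadingCoords.coordOpK_comp b _ _).symm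

/-- constant families: mixed ∘ plain. [cite: Balaban1985BackgroundPropagators, (3.126) p.420, dictionary] -/
theorem coordOpKH_const_comp_coordOpK_const {T T' D' : Type} (A : (T' → 𝔸) →ₗ[ℝ] (T → 𝔸)) (C : Module.End ℝ (T' → 𝔸)) :
    coordOpKH b (fun _ : D' => A) ∘ₗ coordOpK b (fun _ : D' => C) = coordOpKH b (fun _ : D' => A ∘ₗ C) := coordOpKH_comp_coordOpK b _ _

/-- constant families: plain ∘ mixed. [cite: Balaban1985BackgroundPropagators, (3.126) p.420, dictionary] -/
theorem coordOpK_const_comp_coordOpKH_const {T T' D' : Type} (A : Module.End ℝ (T → 𝔸)) (C : (T' → 𝔸) →ₗ[ℝ] (T → 𝔸)) :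
    coordOpK b (fun _ : D' => A) ∘ₗ coordOpKH b (fun _ : D' => C) = coordOpKH b (fun _ : D' => A ∘ₗ C) := B9CoReadingCoordsH.coordOpK_comp_coordOpKH b _ _

/-- constant families: mixed ∘ mixed. [cite: Balaban1985BackgroundPropagators, (3.127) p.421, dictionary] -/
theorem coordOpKH_const_comp_coordOpKH_const {T T' T'' D' : Type} (A : (T' → 𝔸) →ₗ[ℝ] (T → 𝔸)) (C : (T'' → 𝔸) →ₗ[ℝ] (T' → 𝔸)) :
    coordOpKH b (fun _ : D' => A) ∘ₗ coordOpKH b (fun _ : D' => C) = coordOpKH b (fun _ : D' => A ∘ₗ C) := coordOpKH_comp_coordOpKH b _ _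

end Helpers

/-! ## §5 The pinned models of the eleven free `Ops` fields at def-Y's Sect.-D letters (memo §1): scalings forced by `GcoK ∕ HcoK` -/

section Pins

open B6KLevelCensusIndexV1 (KIdx)
open B9CoReadingCoords (XBK GcoK)
open B9CoReadingCoordsH (XHK HcoK)
open B9CoReadingCoordsS (XSK)
open B9Eq3132SectDLetters (deltaPiAY GDY QGQinvY HDY deltaPiAY_mul_GDY)

variable [CompleteSpace 𝔸] [FiniteDimensional ℝ 𝔸]
variable {d ℓ : ℕ} {hd : 1 ≤ d + 1} {hL : Odd (ℓ + 1) ∧ 1 < ℓ + 1} {b₀ b₁ : ℝ} (i : KIdx d ℓ hd hL b₀ b₁)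
  (b : Module.Basis κ ℝ 𝔸) (B : B9.Backgrounds) (cfg : B.Cfg → CfgY 𝔸 i)
  (parS : SiteParY 𝔸 i) (parB : BondParY 𝔸 i) (Gp : SiteOpY 𝔸 i) (Δ2 : BondOpY 𝔸 i)

/-- the model of `Δ_a(U)` = print's `G₀⁻¹` (p.421), scaled `c⁻¹` (the inverse scaling of `GcoK`). [cite: Balaban1985BackgroundPropagators, (3.26) p.395, p.421 («G₀»)] -/
def S0coK (U₁ : B.Cfg) : (XBK κ i → ℝ) →ₗ[ℝ] (XBK κ i → ℝ) :=
  (cR39 b)⁻¹ • coordOpK b (fun _ : Fin (d + 1) => (deltaAY i parS parB Gp (cfg U₁)).restrictScalars ℝ)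

/-- the model of `Δ′_π(U)` (3.121), scaled `c⁻¹`. [cite: Balaban1985BackgroundPropagators, (3.121) p.420] -/
def TpicoK (U₁ : B.Cfg) : (XBK κ i → ℝ) →ₗ[ℝ] (XBK κ i → ℝ) :=
  (cR39 b)⁻¹ • coordOpK b (fun _ : Fin (d + 1) => (deltaPiPrimeY i parS Gp (cfg U₁)).restrictScalars ℝ)

/-- the model of `Δ⁽²⁾_π(U)` (3.135), scaled `c⁻¹`. [cite: Balaban1985BackgroundPropagators, (3.135) p.422] -/
def T2coK (U₁ : B.Cfg) : (XBK κ i → ℝ) →ₗ[ℝ] (XBK κ i → ℝ) :=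
  (cR39 b)⁻¹ • coordOpK b (fun _ : Fin (d + 1) => (delta2PiY i parS Gp Δ2 (cfg U₁)).restrictScalars ℝ)

/-- the model of `Q(U)` (fine bonds → coarse bonds), scaled `c⁻¹`. [cite: Balaban1985BackgroundPropagators, (3.13) p.393, (3.35) p.396] -/
def QcoKH (U₁ : B.Cfg) : (XBK κ i → ℝ) →ₗ[ℝ] (XHK κ i → ℝ) :=
  (cR39 b)⁻¹ • coordOpKH b (fun _ : Fin (d + 1) => (QY i parB (cfg U₁)).restrictScalars ℝ)

/-- the model of `Q*(U)`, scaled `c⁻¹`. [cite: Balaban1985BackgroundPropagators, (3.13) p.393 (Q* the adjoint of Q)] -/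
def QscoKH (U₁ : B.Cfg) : (XHK κ i → ℝ) →ₗ[ℝ] (XBK κ i → ℝ) :=
  (cR39 b)⁻¹ • coordOpKH b (fun _ : Fin (d + 1) => (QsY i parB (cfg U₁)).restrictScalars ℝ)

/-- the model of `C = (QGQ*)⁻¹(U)` (3.123)∕(3.132), scaled `c`. [cite: Balaban1985BackgroundPropagators, (3.123) p.420, (3.132) p.422] -/
def CcoK (U₁ : B.Cfg) : (XHK κ i → ℝ) →ₗ[ℝ] (XHK κ i → ℝ) :=
  cR39 b • coordOpK b (fun _ : Fin (d + 1) => (QGQinvY i parS parB Gp (cfg U₁)).restrictScalars ℝ)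

/-- the model of `C₁ = (QG₁Q*)⁻¹(U)` (3.132), scaled `c`. [cite: Balaban1985BackgroundPropagators, (3.132) p.422] -/
def C1coK (U₁ : B.Cfg) : (XHK κ i → ℝ) →ₗ[ℝ] (XHK κ i → ℝ) :=
  cR39 b • coordOpK b (fun _ : Fin (d + 1) => (QG1QinvY i parS parB Gp Δ2 (cfg U₁)).restrictScalars ℝ)

/-- the model of the gauge-sector `D_U` (sites → bonds), unscaled. [cite: Balaban1985BackgroundPropagators, (3.6) p.391, (3.124) p.420] -/
def DvcoKH (U₁ : B.Cfg) : (XSK κ i → ℝ) →ₗ[ℝ] (XBK κ i → ℝ) :=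
  coordOpKH b (fun _ : Fin (d + 1) => (gradY i (cfg U₁)).restrictScalars ℝ)

/-- the model of `D*_U` (bonds → sites), unscaled. [cite: Balaban1985BackgroundPropagators, (3.8) p.392, (3.124) p.420] -/
def DvscoKH (U₁ : B.Cfg) : (XBK κ i → ℝ) →ₗ[ℝ] (XSK κ i → ℝ) :=
  coordOpKH b (fun _ : Fin (d + 1) => (divY i (cfg U₁)).restrictScalars ℝ)

/-- the model of `R(U)` (3.25) on the site carrier, scaled `c⁻¹`. [cite: Balaban1985BackgroundPropagators, (3.25) p.394] -/
def RcoK (U₁ : B.Cfg) : (XSK κ i → ℝ) →ₗ[ℝ] (XSK κ i → ℝ) :=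
  (cR39 b)⁻¹ • coordOpK b (fun _ : Fin (d + 1) => (RY i parS Gp (cfg U₁)).restrictScalars ℝ)

end Pins

/-! ## §6 The ten dischargeable fields of the knit's `Identities` at the pins (memo §2): `invG0′ ∕ invG ∕ invG1 ∕ eq126 ∕ eq129 ∕ eq153 ∕ c1_inv` over any
basis with `cR39 b ≠ 0`, `adjQ ∕ adjDv ∕ symmR` over `trBasis N`.  NOT here (located gap O5): `h124Q ∕ h124R ∕ hR`. -/

section IdentitiesAtPins

open B6KLevelCensusIndexV1 (KIdx)
open B9CoReadingCoords (XBK GcoK coordOpK_comp)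
open B9CoReadingCoordsH (XHK HcoK coordOpK_comp_coordOpKH)
open B9CoReadingCoordsS (XSK)
open B9Eq3132SectDLetters (deltaPiAY GDY QGQinvY HDY deltaPiAY_mul_GDY)

variable [CompleteSpace 𝔸] [FiniteDimensional ℝ 𝔸]
variable {d ℓ : ℕ} {hd : 1 ≤ d + 1} {hL : Odd (ℓ + 1) ∧ 1 < ℓ + 1} {b₀ b₁ : ℝ} (i : KIdx d ℓ hd hL b₀ b₁)
  (b : Module.Basis κ ℝ 𝔸) (B : B9.Backgrounds) (cfg : B.Cfg → CfgY 𝔸 i)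
  (parS : SiteParY 𝔸 i) (parB : BondParY 𝔸 i) (Gp : SiteOpY 𝔸 i) (Δ2 : BondOpY 𝔸 i)

variable {i b B cfg parS parB Gp Δ2}

/-- ★ **`invG0′` at the pins: `G₀·Δ_a = 1`** in the model (`GcoK` of `G_A = Δ_a⁻¹` times `S0coK`), wherever `Δ_a(U)` is a unit.
[cite: Balaban1985BackgroundPropagators, (3.27) p.395, p.421 («G₀»)] -/
theorem GcoK_GAY_mul_S0coK (hc : cR39 b ≠ 0) {U₁ : B.Cfg} (hU : IsUnit (deltaAY i parS parB Gp (cfg U₁))) :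
    GcoK i b B cfg (GAY i parS parB Gp) U₁ * S0coK i b B cfg parS parB Gp U₁ = 1 := by
  rw [GcoK, S0coK, Module.End.mul_eq_comp, smul_comp_smul, mul_inv_cancel₀ hc, one_smul, ← coordOpK_const_comp,
    ← Module.End.mul_eq_comp, ← restrictScalars_mul']
  rw [show GAY i parS parB Gp (cfg U₁) * deltaAY i parS parB Gp (cfg U₁) = 1 from GAY_mul_deltaAY i hU, restrictScalars_one']
  exact coordOpK_const_one b

/-- ★ **`invG` at the pins: `(Δ_a − Δ′_π)·G = 1`** (Sect. D's `G = (Δ_π + DRD* + Q*aQ)⁻¹`, (3.122) = (3.26) − (3.121)), wherever `G̃⁻¹(U)` is a unit.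
[cite: Balaban1985BackgroundPropagators, (3.122) p.420, (3.130) p.421] -/
theorem S0coK_sub_TpicoK_mul_GcoK_GDY (hc : cR39 b ≠ 0) {U₁ : B.Cfg} (hU : IsUnit (deltaPiAY i parS parB Gp (cfg U₁))) :
    (S0coK i b B cfg parS parB Gp U₁ - TpicoK i b B cfg parS Gp U₁) * GcoK i b B cfg (GDY i parS parB Gp) U₁ = 1 := by
  rw [S0coK, TpicoK, GcoK, Module.End.mul_eq_comp, LinearMap.sub_comp, smul_comp_smul, smul_comp_smul, inv_mul_cancel₀ hc, one_smul, one_smul,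
    ← coordOpK_const_comp, ← coordOpK_const_comp, ← coordOpK_const_sub, ← LinearMap.sub_comp, ← restrictScalars_sub', ← deltaPiAY_eq_deltaAY_sub,
    ← Module.End.mul_eq_comp, ← restrictScalars_mul']
  rw [show deltaPiAY i parS parB Gp (cfg U₁) * GDY i parS parB Gp (cfg U₁) = 1 from deltaPiAY_mul_GDY hU, restrictScalars_one']
  exact coordOpK_const_one b

/-- ★ **`invG1` at the pins: `(Δ_a − (Δ′_π + Δ⁽²⁾_π))·G₁ = 1`** ((3.128) via (3.138)), wherever (3.128) is a unit.
[cite: Balaban1985BackgroundPropagators, (3.128) p.421, (3.138) p.422] -/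
theorem S0coK_sub_mul_GcoK_G1Y (hc : cR39 b ≠ 0) {U₁ : B.Cfg} (hU : IsUnit (deltaOneY i parS parB Gp Δ2 (cfg U₁))) :
    (S0coK i b B cfg parS parB Gp U₁ - (TpicoK i b B cfg parS Gp U₁ + T2coK i b B cfg parS Gp Δ2 U₁)) * GcoK i b B cfg (G1Y i parS parB Gp Δ2) U₁ = 1 := by
  rw [S0coK, TpicoK, T2coK, GcoK, Module.End.mul_eq_comp, LinearMap.sub_comp, LinearMap.add_comp, smul_comp_smul, smul_comp_smul, smul_comp_smul,
    inv_mul_cancel₀ hc, one_smul, one_smul, one_smul, ← coordOpK_const_comp, ← coordOpK_const_comp, ← coordOpK_const_comp, ← coordOpK_const_add,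
    ← coordOpK_const_sub, ← LinearMap.add_comp, ← LinearMap.sub_comp, ← restrictScalars_add', ← restrictScalars_sub', ← deltaOneY_eq_deltaAY_sub,
    ← Module.End.mul_eq_comp, ← restrictScalars_mul', deltaOneY_mul_G1Y hU, restrictScalars_one']
  exact coordOpK_const_one b

/-- ★ **`eq126` at the pins: `H = G ∘ Q* ∘ C`** (3.126) — definitional for def-Y's `HDY`, the scalings `c·c⁻¹·c = c` matching `HcoK`'s.
[cite: Balaban1985BackgroundPropagators, (3.126) p.420] -/
theorem HcoK_HDY_eq (hc : cR39 b ≠ 0) (U₁ : B.Cfg) :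
    HcoK i b B cfg (HDY i parS parB Gp) U₁ = GcoK i b B cfg (GDY i parS parB Gp) U₁ ∘ₗ QscoKH i b B cfg parB U₁ ∘ₗ CcoK i b B cfg parS parB Gp U₁ := by
  rw [HcoK, GcoK, QscoKH, CcoK, smul_comp_smul, smul_comp_smul, inv_mul_cancel₀ hc, mul_one, coordOpKH_const_comp_coordOpK_const,
    coordOpK_const_comp_coordOpKH_const]
  rfl

/-- ★ **`eq129` at the pins: `H₁ = G₁ ∘ Q* ∘ C₁`** (3.129). [cite: Balaban1985BackgroundPropagators, (3.129) p.421] -/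
theorem HcoK_H1Y_eq (hc : cR39 b ≠ 0) (U₁ : B.Cfg) :
    HcoK i b B cfg (H1Y i parS parB Gp Δ2) U₁ = GcoK i b B cfg (G1Y i parS parB Gp Δ2) U₁ ∘ₗ QscoKH i b B cfg parB U₁ ∘ₗ C1coK i b B cfg parS parB Gp Δ2 U₁ := by
  rw [HcoK, GcoK, QscoKH, C1coK, smul_comp_smul, smul_comp_smul, inv_mul_cancel₀ hc, mul_one, coordOpKH_const_comp_coordOpK_const,
    coordOpK_const_comp_coordOpKH_const]
  rfl

/-- ★ **`c1_inv` at the pins: `Q ∘ G₁ ∘ Q* ∘ C₁ = id`** ((3.127) for G₁: `QH₁ = I`), wherever `(QG₁Q*)(U)` is a unit.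
[cite: Balaban1985BackgroundPropagators, (3.127) p.421, (3.132) p.422] -/
theorem QcoKH_G1_Qs_C1_eq_id (hc : cR39 b ≠ 0) {U₁ : B.Cfg} (hU : IsUnit (QGQOfY i parB (G1Y i parS parB Gp Δ2) (cfg U₁))) :
    QcoKH i b B cfg parB U₁ ∘ₗ GcoK i b B cfg (G1Y i parS parB Gp Δ2) U₁ ∘ₗ QscoKH i b B cfg parB U₁ ∘ₗ C1coK i b B cfg parS parB Gp Δ2 U₁ = LinearMap.id := by
  rw [QcoKH, GcoK, QscoKH, C1coK, smul_comp_smul, smul_comp_smul, smul_comp_smul, inv_mul_cancel₀ hc, mul_one, inv_mul_cancel₀ hc, one_smul,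
    coordOpKH_const_comp_coordOpK_const, coordOpK_const_comp_coordOpKH_const, coordOpKH_const_comp_coordOpKH_const]
  have h : (QY i parB (cfg U₁)).restrictScalars ℝ ∘ₗ ((G1Y i parS parB Gp Δ2 (cfg U₁)).restrictScalars ℝ ∘ₗ
      ((QsY i parB (cfg U₁)).restrictScalars ℝ ∘ₗ (QG1QinvY i parS parB Gp Δ2 (cfg U₁)).restrictScalars ℝ)) =
      (LinearMap.id : (IBondY i → 𝔸) →ₗ[ℝ] (IBondY i → 𝔸)) := by
    show (QY i parB (cfg U₁) ∘ₗ H1Y i parS parB Gp Δ2 (cfg U₁)).restrictScalars ℝ = _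
    rw [QY_comp_H1Y hU]; rfl
  rw [h, coordOpKH_eq_coordOpK]
  exact coordOpK_id b

/-- ★★ **`eq153` at the pins: `𝔊 = G₁ ∘ 𝔓*`** with `𝔓* = I − Q*C₁QG₁ − DRD*G₁` spelled exactly as the knit's `frakPstar` (3.147)∕(3.153) — from def-Y's
`GGY_eq_3153`; all scalings cancel. [cite: Balaban1985BackgroundPropagators, (3.147) p.425, (3.153) p.426] -/
theorem GcoK_GGY_eq_frakPstar (hc : cR39 b ≠ 0) (U₁ : B.Cfg) :
    GcoK i b B cfg (GGY i parS parB Gp Δ2) U₁ =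
      GcoK i b B cfg (G1Y i parS parB Gp Δ2) U₁ ∘ₗ
        (LinearMap.id - QscoKH i b B cfg parB U₁ ∘ₗ C1coK i b B cfg parS parB Gp Δ2 U₁ ∘ₗ QcoKH i b B cfg parB U₁ ∘ₗ GcoK i b B cfg (G1Y i parS parB Gp Δ2) U₁
          - DvcoKH i b B cfg U₁ ∘ₗ RcoK i b B cfg parS Gp U₁ ∘ₗ DvscoKH i b B cfg U₁ ∘ₗ GcoK i b B cfg (G1Y i parS parB Gp Δ2) U₁) := by
  have hX : QscoKH i b B cfg parB U₁ ∘ₗ C1coK i b B cfg parS parB Gp Δ2 U₁ ∘ₗ QcoKH i b B cfg parB U₁ ∘ₗ GcoK i b B cfg (G1Y i parS parB Gp Δ2) U₁ =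
      coordOpK b (fun _ : Fin (d + 1) => (QsY i parB (cfg U₁) ∘ₗ QG1QinvY i parS parB Gp Δ2 (cfg U₁) ∘ₗ QY i parB (cfg U₁) ∘ₗ
        G1Y i parS parB Gp Δ2 (cfg U₁)).restrictScalars ℝ) := by
    rw [QscoKH, C1coK, QcoKH, GcoK, smul_comp_smul, smul_comp_smul, smul_comp_smul, inv_mul_cancel₀ hc, mul_one, inv_mul_cancel₀ hc, one_smul,
      coordOpKH_const_comp_coordOpK_const, coordOpK_const_comp_coordOpKH_const, coordOpKH_const_comp_coordOpKH_const, coordOpKH_eq_coordOpK]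
    rfl
  have hY : DvcoKH i b B cfg U₁ ∘ₗ RcoK i b B cfg parS Gp U₁ ∘ₗ DvscoKH i b B cfg U₁ ∘ₗ GcoK i b B cfg (G1Y i parS parB Gp Δ2) U₁ =
      coordOpK b (fun _ : Fin (d + 1) => (gradY i (cfg U₁) ∘ₗ RY i parS Gp (cfg U₁) ∘ₗ divY i (cfg U₁) ∘ₗ G1Y i parS parB Gp Δ2 (cfg U₁)).restrictScalars ℝ) := by
    rw [DvcoKH, RcoK, DvscoKH, GcoK, LinearMap.comp_smul, LinearMap.comp_smul, LinearMap.comp_smul, LinearMap.smul_comp, LinearMap.comp_smul, smul_smul,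
      mul_inv_cancel₀ hc, one_smul, coordOpKH_const_comp_coordOpK_const, coordOpK_const_comp_coordOpKH_const, coordOpKH_const_comp_coordOpKH_const,
      coordOpKH_eq_coordOpK]
    rfl
  rw [hX, hY, GcoK, GcoK, LinearMap.smul_comp]
  congr 1
  rw [← coordOpK_id b, ← coordOpK_const_sub, ← coordOpK_const_sub, ← coordOpK_const_comp]
  congr 1
  funext ν
  rw [GGY_eq_3153, LinearMap.comp_sub, LinearMap.comp_sub, LinearMap.comp_id]
  exact LinearMap.ext fun _ => rfl

end IdentitiesAtPins

/-! ## §7 `adjQ ∕ adjDv ∕ symmR` at the pins over the trace basis (no basis hypothesis): G-valued ∕ unitary-valued configurations -/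

section TransposesAtPins

open B6KLevelCensusIndexV1 (KIdx)
open B9CoReadingCoords (XBK)
open B9CoReadingCoordsH (XHK)
open B9CoReadingCoordsS (XSK)
open B9CoReadingCoordsTranspose (isTransposePair_coordOpK_of_isSymmTr)

variable {N : ℕ} {d ℓ : ℕ} {hd : 1 ≤ d + 1} {hL : Odd (ℓ + 1) ∧ 1 < ℓ + 1} {b₀ b₁ : ℝ} (i : KIdx d ℓ hd hL b₀ b₁)
  (B : B9.Backgrounds) (cfg : B.Cfg → CfgY (Matrix (Fin N) (Fin N) ℂ) i) (U₁ : B.Cfg)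

/-- ★★ **`adjQ` at the pins**: `QcoKH f ⬝ᵥ g = f ⬝ᵥ QscoKH g` for the taxicab transporters `parBY` and a `G`-valued configuration, `G ≤ U(N)`.
[cite: Balaban1985BackgroundPropagators, (3.13) p.393 (Q* the adjoint of Q), (3.35) p.396] -/
theorem isTransposePair_QcoKH_QscoKH {G : Subgroup (Matrix (Fin N) (Fin N) ℂ)ˣ} (hG : G ≤ B7Prop2Explicit.unitaryUnits (Matrix (Fin N) (Fin N) ℂ))
    (hU : ∀ μ x, cfg U₁ μ x ∈ G) :
    IsTransposePair (QcoKH i (trBasis N) B cfg (parBY i) U₁) (QscoKH i (trBasis N) B cfg (parBY i) U₁) :=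
  isTransposePair_QY_QsY_coords i B cfg U₁ hG hU _

/-- ★★ **`adjDv` at the pins**: `DvcoKH s ⬝ᵥ f = s ⬝ᵥ DvscoKH f` at a unitary-valued configuration. [cite: Balaban1985BackgroundPropagators, (3.8) p.392, (3.124) p.420] -/
theorem isTransposePair_DvcoKH_DvscoKH
    (hU : ∀ μ x, ((cfg U₁ μ x : (Matrix (Fin N) (Fin N) ℂ)ˣ) : Matrix (Fin N) (Fin N) ℂ) ∈ unitary (Matrix (Fin N) (Fin N) ℂ)) :
    IsTransposePair (DvcoKH i (trBasis N) B cfg U₁) (DvscoKH i (trBasis N) B cfg U₁) :=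
  isTransposePair_gradY_divY_coords i B cfg U₁ hU

/-- ★★ **`symmR` at the pins**: the model of `R(U)` at the record's site transporter `parSymY` and `G′ = GpY parSymY` is its own transpose, for a `G`-valued
configuration, `G ≤ U(N)` (n06-j `RY_parSymY_isSymmTr`). [cite: Balaban1985BackgroundPropagators, (3.25) p.394, Thm 3.11 p.416 («symmetric»)] -/
theorem isTransposePair_RcoK {G : Subgroup (Matrix (Fin N) (Fin N) ℂ)ˣ} (hG : G ≤ B7Prop2Explicit.unitaryUnits (Matrix (Fin N) (Fin N) ℂ))
    (hU : ∀ μ x, cfg U₁ μ x ∈ G) :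
    IsTransposePair (RcoK i (trBasis N) B cfg (parSymY i) (GpY i (parSymY i)) U₁) (RcoK i (trBasis N) B cfg (parSymY i) (GpY i (parSymY i)) U₁) :=
  isTransposePair_smul_smul
    (isTransposePair_coordOpK_of_isSymmTr (trBasis N) (trBasis_repr_eq_trace N) _ (B9Thm311ProjectionR.RY_parSymY_isSymmTr i hG hU)) _

end TransposesAtPins

end Literature.MathematicalPhysics.QuantumFieldTheory.Balaban1983to89.Node00.OpsYSectDCoords
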